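import Mathlib
import Summits.KontsevichZagierPeriods.Zeta5Search.BrickTopKummer
import Summits.KontsevichZagierPeriods.Zeta5Search.BrickPhiAllPrimes

/-!
# BrickCellsAllPrimes — the cells of the CENTRE-FREE brick kernel `(A,B,0)` at EVERY prime, `p = 2` included: Kummer's
compensated top valuation, `p^{L(A−s)}·c̃_{K,s}(n) ∈ ℤ_(p)` for `n < p^{L+1}`, one-digit integrality, and the exact top
law `v_p(c̃_{Kp,A}(np)) = v_p(c̃_{K,A}(n))` (cell `pub-zeta5`, seat ct-1 g42)

HONEST FRAMING: systematic search; no irrationality claim unless certified.  INSTRUMENT lemmas about the Laurent cells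
`cell A B 0 n K s = c̃_{K,s}(n)` and the top coefficient `cTop A B ε n K = c_{K,A}(n) = ±(n/2−K)^ε C(n,K)^A[C(n+K,K)C(2n−K,n)]^B`
of the brick kernels (`BrickLaurent`, `BrickTopCoefficient`); nothing about `ζ(5)`/`ζ(3)`; no `γ`/record statement; records
in print UNMOVED; NOTHING IS DISCHARGED (net named-fact debt 0).

WHY: the `p = 2` residual of `Zudilin2002.integrality` concerns the centre-free kernel `(6,1,0)` (ct-1 g41,
`integrality_of_propositionH_two`).  In the zeta5-irr chain the cell valuation bounds `BrickTopKummer.padicValuation_cTop_le`,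
`cell_valuation_abs`, `laurent_valuation_abs`, `cell_integral_of_lt` carry `p ≠ 2` for ONE reason: the centre factor
`(n/2 − K)^ε` of the full kernel is `p`-integral only for odd `p`.  For `ε = 0` that factor is `1`, and the bounds hold at
every prime with the tree's own proof (`BrickCellValuation.cell_valuation` is prime-free):

* `padicValuation_cTop_zero_le` — `v(c̃_{K,A}(n)) ≤ exp(−B·σ^{(L)}_K)` for `K ≤ n < p^{L+1}` (Kummer pays the distant roots);
* **`cell_zero_valuation_abs`** — `v(c̃_{K,s}(n)) ≤ exp(L(A−s))`, i.e. `p^{L(A−s)}c̃_{K,s}(n) ∈ ℤ_(p)` (`2B ≤ A`);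
  `laurent_zero_valuation_abs`; **`cell_zero_integral_of_lt`** (`n < p`: `c̃_{K,s}(n) ∈ ℤ_(p)` — at `p = 2` the rows `n ≤ 1`);
* **`padicValuation_cTop_mul_prime'`** — `v(c_{Kp,A}(np)) = p^{−ε}·v(c_{K,A}(n))` for EVERY prime and every `ε` (`2B ≤ A`):
  the tree's `BrickPhiSymmetry.padicValuation_cTop_mul_prime` needs `p ≥ 5` for the unit `Φ_{n,p}(−K)`, which
  `BrickPhiAllPrimes.padicValuation_brickPhi_neg_eq_one'` now gives at every prime; `padicValuation_lambda_zero_eq_one`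
  (the ratio `λ = c̃_{Kp,A}(np)/c̃_{K,A}(n)` is a `p`-adic unit, `ε = 0`);
* `p = 2` instances `cell_zero_two_valuation_abs`, `cell_zero_two_integral`.

Theorems only (0 `def`); tree vocabulary; nothing restated (the odd-`p` forms stay the tree's).
-/

namespace Summit.KontsevichZagierPeriods.Zeta5Search.BrickCellsAllPrimes

open Finset Nat WithZero
open Summit.KontsevichZagierPeriods.Zeta5Search.BrickTopCoefficient (cTop)
open Summit.KontsevichZagierPeriods.Zeta5Search.BrickTopFrobenius (cTop_mul_prime)
open Summit.KontsevichZagierPeriods.Zeta5Search.BrickLaurent (laurent cell)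
open Summit.KontsevichZagierPeriods.Zeta5Search.BrickCellValuation (sigmaTop cell_valuation laurent_valuation)
open Summit.KontsevichZagierPeriods.Zeta5Search.BrickTopKummer (padicValuation_choose_add_le)
open Summit.KontsevichZagierPeriods.Zeta5Search.BrickPhiAllPrimes (padicValuation_brickPhi_neg_eq_one')
open Literature.NumberTheory.LFunctions (padicValuation_natCast_le_one)

noncomputable section

variable {p : ℕ} [Fact p.Prime]

/-- **`ṽ_K ≥ 0` for the centre-free kernel at EVERY prime**: for `K ≤ n < p^{L+1}` and every `A, B`,
`v(cTop A B 0 n K) ≤ exp(−B·σ^{(L)}_K)` (Kummer: `C(n+K,K)` and `C(2n−K,n)` each pay one `p` when their sum reaches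
`p^{L+1}`).  The tree's `BrickTopKummer.padicValuation_cTop_le` is the same for every `ε` but odd `p`. -/
theorem padicValuation_cTop_zero_le (A B : ℕ) {L n K : ℕ} (hn : n < p ^ (L + 1)) (hK : K ≤ n) :
    Rat.padicValuation p (cTop A B 0 n K) ≤ exp (-((B * sigmaTop p L n K : ℕ) : ℤ)) := by
  have h1 : Rat.padicValuation p ((-1 : ℚ) ^ (n * B + K * A)) = 1 := by
    rw [map_pow, Valuation.map_neg, map_one, one_pow]
  have h3 : Rat.padicValuation p ((n.choose K : ℚ) ^ A) ≤ 1 := by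
    rw [map_pow]; exact pow_le_one' (padicValuation_natCast_le_one _) _
  have h4 : Rat.padicValuation p ((((n + K).choose K : ℚ) * ((2 * n - K).choose n : ℚ)) ^ B) ≤
      exp (-((B * sigmaTop p L n K : ℕ) : ℤ)) := by
    have key : exp (-((B * sigmaTop p L n K : ℕ) : ℤ)) =
        (exp (-((if p ^ (L + 1) ≤ n + K then 1 else 0 : ℕ) : ℤ)) *
          exp (-((if p ^ (L + 1) ≤ 2 * n - K then 1 else 0 : ℕ) : ℤ))) ^ B := by
      rw [← exp_add, ← exp_nsmul, nsmul_eq_mul, sigmaTop]; congr 1; push_cast; ring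
    rw [map_pow, map_mul, key]
    refine pow_le_pow_left' (mul_le_mul' (padicValuation_choose_add_le hn (by omega)) ?_) B
    have h := padicValuation_choose_add_le (p := p) (L := L) (n := n - K) (k := n) (by omega) hn
    rwa [show n - K + n = 2 * n - K by omega] at h
  unfold cTop
  rw [map_mul, map_mul, map_mul, h1, one_mul, pow_zero, map_one, one_mul]
  calc _ ≤ 1 * exp (-((B * sigmaTop p L n K : ℕ) : ℤ)) := mul_le_mul' h3 h4
    _ = _ := one_mul _

/-- **(C3⁺) absolute form for the centre-free kernel at EVERY prime**: for `K ≤ n < p^{L+1}`, `2B ≤ A`, every `s`: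
`v(cell A B 0 n K s) ≤ exp(L·(A − s))`, i.e. **`p^{L(A−s)}·c̃_{K,s}(n) ∈ ℤ_(p)`**. -/
theorem cell_zero_valuation_abs {A B : ℕ} (hAB : 2 * B ≤ A) {L n K : ℕ} (hn : n < p ^ (L + 1)) (hK : K ≤ n) (s : ℕ) :
    Rat.padicValuation p (cell A B 0 n K s) ≤ exp ((L : ℤ) * (A - s : ℕ)) := by
  refine (cell_valuation hAB hn hK (Or.inr rfl) s).trans ?_
  calc Rat.padicValuation p (cTop A B 0 n K) * exp ((L : ℤ) * (A - s : ℕ) + (B * sigmaTop p L n K : ℕ))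
      ≤ exp (-((B * sigmaTop p L n K : ℕ) : ℤ)) * exp ((L : ℤ) * (A - s : ℕ) + (B * sigmaTop p L n K : ℕ)) :=
        mul_le_mul' (padicValuation_cTop_zero_le A B hn hK) le_rfl
    _ = exp ((L : ℤ) * (A - s : ℕ)) := by rw [← exp_add]; congr 1; ring

/-- The same in depth form: `v(laurent A B 0 n K d) ≤ exp(L·d)`, i.e. `p^{Ld}·[T^d]F_K ∈ ℤ_(p)` — every prime. -/
theorem laurent_zero_valuation_abs {A B : ℕ} (hAB : 2 * B ≤ A) {L n K : ℕ} (hn : n < p ^ (L + 1)) (hK : K ≤ n)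
    (d : ℕ) : Rat.padicValuation p (laurent A B 0 n K d) ≤ exp ((L : ℤ) * d) := by
  refine (laurent_valuation hAB hn hK (Or.inr rfl) d).trans ?_
  calc Rat.padicValuation p (cTop A B 0 n K) * exp ((L : ℤ) * d + (B * sigmaTop p L n K : ℕ))
      ≤ exp (-((B * sigmaTop p L n K : ℕ) : ℤ)) * exp ((L : ℤ) * d + (B * sigmaTop p L n K : ℕ)) :=
        mul_le_mul' (padicValuation_cTop_zero_le A B hn hK) le_rfl
    _ = exp ((L : ℤ) * d) := by rw [← exp_add]; congr 1; ring

/-- **ONE-DIGIT INTEGRALITY at EVERY prime** (centre-free kernel): for `K ≤ n < p`, `2B ≤ A`: `c̃_{K,s}(n) ∈ ℤ_(p)` for every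
`s`.  At `p = 2` these are the two rows `n = 0, 1`. -/
theorem cell_zero_integral_of_lt {A B : ℕ} (hAB : 2 * B ≤ A) {n K : ℕ} (hn : n < p) (hK : K ≤ n) (s : ℕ) :
    Rat.padicValuation p (cell A B 0 n K s) ≤ 1 := by
  have h := cell_zero_valuation_abs hAB (L := 0) (by simpa using hn) hK s
  rwa [Nat.cast_zero, zero_mul, exp_zero] at h

/-- **The exact top law at EVERY prime**: `v(c_{Kp,A}(np)) = p^{−ε}·v(c_{K,A}(n))` for `2B ≤ A`, every `ε`, `K ≤ n`
(`BrickTopFrobenius.cTop_mul_prime` with the unit `Φ_{n,p}(−K)` of `BrickPhiAllPrimes.padicValuation_brickPhi_neg_eq_one'`;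
the tree's `BrickPhiSymmetry.padicValuation_cTop_mul_prime` has `p ≥ 5`). -/
theorem padicValuation_cTop_mul_prime' {A B : ℕ} (hAB : 2 * B ≤ A) (ε : ℕ) {n K : ℕ} (hK : K ≤ n) :
    Rat.padicValuation p (cTop A B ε (n * p) (K * p)) = exp (-(ε : ℤ)) * Rat.padicValuation p (cTop A B ε n K) := by
  have hp : p.Prime := Fact.out
  rw [cTop_mul_prime hAB ε hp.pos hK, map_mul, map_mul, map_pow, Rat.padicValuation_self,
    show (-(K : ℚ)) = -((K : ℤ) : ℚ) by push_cast; ring, padicValuation_brickPhi_neg_eq_one' A B n (K : ℤ), mul_one,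
    ← exp_nsmul, nsmul_eq_mul, mul_neg_one]

/-- **The ratio `λ = c̃_{Kp,A}(np)/c̃_{K,A}(n)` of top coefficients of the centre-free kernel is a `p`-adic unit** — every
prime (`2B ≤ A`, `K ≤ n`): `v(c̃_{Kp,A}(np)) = v(c̃_{K,A}(n))`. -/
theorem padicValuation_cTop_zero_mul_prime {A B : ℕ} (hAB : 2 * B ≤ A) {n K : ℕ} (hK : K ≤ n) :
    Rat.padicValuation p (cTop A B 0 (n * p) (K * p)) = Rat.padicValuation p (cTop A B 0 n K) := by
  rw [padicValuation_cTop_mul_prime' hAB 0 hK, Nat.cast_zero, neg_zero, exp_zero, one_mul]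

/-- `p = 2`: **`2^{L(A−s)}·c̃_{K,s}(n) ∈ ℤ_(2)`** for `K ≤ n < 2^{L+1}`, `2B ≤ A`. -/
theorem cell_zero_two_valuation_abs {A B : ℕ} (hAB : 2 * B ≤ A) {L n K : ℕ} (hn : n < 2 ^ (L + 1)) (hK : K ≤ n)
    (s : ℕ) : @Rat.padicValuation 2 ⟨Nat.prime_two⟩ (cell A B 0 n K s) ≤ exp ((L : ℤ) * (A - s : ℕ)) :=
  @cell_zero_valuation_abs 2 ⟨Nat.prime_two⟩ A B hAB L n K hn hK s

end

end Summit.KontsevichZagierPeriods.Zeta5Search.BrickCellsAllPrimes
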